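import Summits.CriticalPhenomena.SAWScalingLimit.Theses.SAWTwistedSelfEnergy
import Literature.Probability.RandomPlanarGeometry.TwistedLaceExpansionIdentity

/-!
# Disproof work file of crux `TwistedKernelSummable` (stmt-CriticalPhenomena-17872) — findings

Refuter crux-attack (refuter-rattack-stmt-CriticalPhenomena-17872-0, 2026-08-17). No `sorry`.
Nothing here proves or refutes the crux; it pins down WHAT the typed crux says, kernel-checked:

1. `crux_iff` (`Iff.rfl`) — READ-BACK: the item's `let`-statement is, definitionally,
   `∀ K, IsMixedKernel K → Summable (x_c^n Σ|K_n(z)(ι,κ)|)` where `IsMixedKernel` is the MIXED resolvent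
   recursion `G_n = G_{n-1} ⋆ D + Σ_{m=1}^{n} K_m ⋆ G_{n-m}`: the free step is APPENDED (last-step form,
   `Σ_{κ'} G_{n-1}(z-e_κ)(ι,κ') T(κ',κ)`) while the kernel is PREPENDED (first-step form). The item's own
   docstring says `G_n = T·G_{n-1} + Σ K_m ⋆ G_{n-m}` and the card (`twisted-self-energy-half-cr`, K1) says
   `(I − xT_σ)F = E + Π^σ ∗ F` — both FIRST-STEP. The Lean letter is not the informal statement.
2. `isMixedKernel_kern`, `isMixedKernel_unique`, `crux_iff_kern` — the hypothesis is satisfiable (explicit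
   course-of-values recursion `kern`; NOT vacuous) and has exactly one solution from length 1 on, so the
   crux is EQUIVALENT to the `ℓ¹(x_c)`-summability of the single explicit kernel `kern` — the lace
   self-energy CONJUGATED by the full two-point matrix, `K̂ = ĜΠ̂Ĝ⁻¹ = Π̂ − xĜ⋆[Π̂,D]` (`Lines/birth.lean`).
3. `isLaceKernel_lace`, `isLaceKernel_unique`, `repaired_iff_laceKernelSummable` — the REPAIRED statement
   `TwistedKernelSummableFirstStep` (the item with the first-step free term
   `Matrix.of (fun ι κ => Σ λ, T ι λ * G (n-1) (z - dir λ) λ κ)`, everything else verbatim) has the unique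
   solution `twistedLaceCoefficient (5/8)` (landed identity `LaceExpansion.twistedTwoPoint_succ`) and is
   EQUIVALENT to `LaceKernelSummable` = `Σ_{(n,z)} x_c^n Σ|Π^{5/8}_n(z)(ι,κ)| < ∞`, the card's K1 and
   `stub_laceKernelSummable` of `Lines/birth.lean`.

## Numerical findings (exact enumeration to n = 30; twistsaw.c, kit job j024354; entrywise ℓ¹ norms, x_c = 1/μ)
`x_c^n‖K_n‖₁` (typed, = `kern`): .324 .315 .287 .281 .257 .253 .234 .231 .214 .212 .198 .196 .184 .183
.172 .171 .162 .162 .153 (n = 12..30), local exponent 0.80–0.85, FLAT over a factor 2.5 in n — partial sums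
7.66 at n = 30, growing ≈ 0.155/step;
`x_c^n‖Π_n‖₁` (repaired): .0476 .0392 .0397 .0307 .0331 .0251 .0281 .0210 .0242 .0179 .0212 .0155 .0187
.0137 .0166 .0122 .0150 .0109 .0135, local exponent (same parity) 1.36→1.451 (even, rising) / 1.72→1.511
(odd, falling), partial sums 1.437 converging;
the surcharge `Corr = Π − K = xĜ⋆[Π̂,D]` carries 90–97 % of `‖K_n‖₁`, has support radius `n − 4`
(`Π`: ≈ n/4) and a GROWING first absolute moment (1.15 → 1.46): it is a zero-mass stencil convolved
with the full critical twisted two-point matrix (`x_c^n‖G_n‖₁`: 6.29 → 6.11 over n = 7..30), i.e.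
`‖Corr_n‖₁ ≍ ‖G_n‖₁·n^{-3/4}` (observed 0.78–0.81). So the typed crux is decided by gradient-summability of `Ĝ(x_c)` (target-level
information: it holds iff `‖G_n‖₁` eventually decays faster than `n^{-1/4}`, e.g. under the DCS decay
`2σ = 5/4` plus winding decorrelation, `n^{-7/16}`), not by the lace self-energy. Verdict: MISSTATED
(convention), repair = first-step free term (also in `TwistedKernelTailIndex`; `TwistedGapEquation`
and `TwistedKernelLowOrder` are convention-insensitive: zero mass of `Corr`, `K_n = Π_n` for `n ≤ 4`).
-/

noncomputable section

open scoped BigOperators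
open Literature.Probability.LatticeModels
open Literature.Probability.RandomPlanarGeometry.LaceExpansion
open Literature.Probability.RandomPlanarGeometry.SAW (criticalFugacity)

namespace Summit.CriticalPhenomena.SAWScalingLimit.Cruxes.TwistedKernelSummable.Disproof

/-! ### 1. The item's vocabulary, named letter for letter -/

/-- The item's step matrix `T` (`dir := stepDir`, `σ := 5/8`); `= twistedStepMatrix (5/8)` by `rfl`. -/
def mixedT : Matrix (Fin 4) (Fin 4) ℂ := fun a b =>
  if stepDir b = -stepDir a then 0 else
    Complex.exp (-Complex.I * (5 / 8 : ℝ) *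
      (turning (-Site.toComplex (stepDir a)) 0 (Site.toComplex (stepDir b)) : ℝ))

/-- The item's two-point matrix `G`. -/
def mixedG : ℕ → Site 2 → Matrix (Fin 4) (Fin 4) ℂ := fun n z ι κ =>
  if n = 0 then (if z = 0 ∧ ι = κ then 1 else 0) else
    ∑ p ∈ ((zdGraph 2).finsetWalkLength n (0 : Site 2) z).filter (fun p => p.IsPath),
      (if p.getVert 1 = -stepDir ι ∨ z - p.getVert (n - 1) ≠ stepDir κ then 0 else
        Complex.exp (-Complex.I * (5 / 8 : ℝ) *
          (winding ((-Site.toComplex (stepDir ι)) :: (p.support.map Site.toComplex)) : ℝ)))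

/-- The `x_c`-weighted entrywise `ℓ¹` functional of the item's conclusion. -/
def l1Weight (K : ℕ → Site 2 → Matrix (Fin 4) (Fin 4) ℂ) : ℕ × Site 2 → ℝ := fun p =>
  criticalFugacity ^ p.1 * ∑ ι : Fin 4, ∑ κ : Fin 4, ‖K p.1 p.2 ι κ‖

/-- The item's hypothesis `IsTwistedKernel`, letter for letter: support in the box of radius `n` and the
MIXED recursion `G_n = G_{n-1} ⋆ D + Σ_{m=1}^{n} K_m ⋆ G_{n-m}` (`n ≥ 1`). -/
def IsMixedKernel (K : ℕ → Site 2 → Matrix (Fin 4) (Fin 4) ℂ) : Prop :=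
  (∀ n z, z ∉ box 2 n → K n z = 0) ∧
  (∀ n, 1 ≤ n → ∀ z, mixedG n z =
    Matrix.of (fun ι κ => ∑ κ' : Fin 4, mixedG (n - 1) (z - stepDir κ) ι κ' * mixedT κ' κ) +
      ∑ m ∈ Finset.Icc 1 n, ∑ y ∈ box 2 m, K m y * mixedG (n - m) (z - y))

/-- The REPAIRED hypothesis: the same with the FIRST-STEP free term `Σ_λ T(ι,λ) G_{n-1}(z-e_λ)(λ,κ)`
(`G_n = D ⋆ G_{n-1} + Σ_{m=1}^{n} K_m ⋆ G_{n-m}`, Slade (3.14) / `twistedTwoPoint_succ`). -/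
def IsLaceKernel (K : ℕ → Site 2 → Matrix (Fin 4) (Fin 4) ℂ) : Prop :=
  (∀ n z, z ∉ box 2 n → K n z = 0) ∧
  (∀ n, 1 ≤ n → ∀ z, mixedG n z =
    Matrix.of (fun ι κ => ∑ lam : Fin 4, mixedT ι lam * mixedG (n - 1) (z - stepDir lam) lam κ) +
      ∑ m ∈ Finset.Icc 1 n, ∑ y ∈ box 2 m, K m y * mixedG (n - m) (z - y))

/-- The repaired crux `C′` (proposed restatement of the item: first-step free term, all else verbatim). -/
def TwistedKernelSummableFirstStep : Prop :=
  ∀ K : ℕ → Site 2 → Matrix (Fin 4) (Fin 4) ℂ, IsLaceKernel K → Summable (l1Weight K)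

/-- `Σ_{(n,z)} x_c^n Σ_{ι,κ} |Π^{5/8}_n(z)(ι,κ)| < ∞` — verbatim `LaceKernelSummable` of `Lines/birth.lean`
(the card's K1 in the lace convention). -/
def LaceKernelSummable : Prop :=
  Summable (l1Weight (twistedLaceCoefficient (5 / 8)))

/-! ### 2. Read-back and bridges -/

/-- READ-BACK: the crux is, definitionally, the summability claim for every MIXED kernel. -/
theorem crux_iff :
    Summit.CriticalPhenomena.SAWScalingLimit.Theses.SAWTwistedSelfEnergy.TwistedKernelSummable ↔
      ∀ K : ℕ → Site 2 → Matrix (Fin 4) (Fin 4) ℂ, IsMixedKernel K → Summable (l1Weight K) :=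
  Iff.rfl

/-- The item's `T` is the Literature's twisted step matrix at `σ = 5/8`. -/
theorem mixedT_eq_twistedStepMatrix : mixedT = twistedStepMatrix (5 / 8) := rfl

/-- The item's `G` is the Literature's twisted two-point matrix at `σ = 5/8`. -/
theorem mixedG_eq_twistedTwoPoint : mixedG = twistedTwoPoint (5 / 8) := by
  funext n z ι κ
  rcases Nat.eq_zero_or_pos n with rfl | hn
  · rw [twistedTwoPoint_zero_apply]
    rfl
  · dsimp only [mixedG]
    rw [if_neg hn.ne', twistedTwoPoint_eq_sum_paths _ hn.ne']

/-- `x_c ≥ 0`. -/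
theorem criticalFugacity_nonneg : 0 ≤ criticalFugacity := by
  have h := Literature.Probability.RandomPlanarGeometry.SAW.Zd.connectiveConstant_pos 2
  rw [Literature.Probability.RandomPlanarGeometry.SAW.Zd.connectiveConstant_two] at h
  unfold Literature.Probability.RandomPlanarGeometry.SAW.criticalFugacity
  exact (inv_pos.2 h).le

theorem l1Weight_nonneg (K : ℕ → Site 2 → Matrix (Fin 4) (Fin 4) ℂ) (p : ℕ × Site 2) :
    0 ≤ l1Weight K p :=
  mul_nonneg (pow_nonneg criticalFugacity_nonneg _)
    (Finset.sum_nonneg fun _ _ => Finset.sum_nonneg fun _ _ => norm_nonneg _)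

/-- Box arithmetic: `y ∈ box a`, `z ∉ box n`, `a ≤ n` ⟹ `z - y ∉ box (n - a)`. -/
theorem sub_notMem_box {a n : ℕ} {y z : Site 2} (hy : y ∈ box 2 a) (hz : z ∉ box 2 n)
    (han : a ≤ n) : z - y ∉ box 2 (n - a) := by
  intro h
  apply hz
  rw [mem_box] at hy h ⊢
  intro i
  have h1 := hy i
  have h2 := h i
  simp only [Pi.sub_apply] at h2
  push_cast [Nat.cast_sub han] at h2
  omega

/-- `z ∉ box 0 ↔ z ≠ 0`, the direction used below. -/
theorem eq_zero_of_not_notMem_box_zero {z : Site 2} (hz : ¬ z ∉ box 2 0) : z = 0 := by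
  funext i
  have hi := (mem_box.1 (not_not.1 hz)) i
  simp only [Nat.cast_zero, neg_zero] at hi
  exact le_antisymm hi.2 hi.1

/-- Convolution with `G_0 = δ E` evaluates at `z` on the box. -/
theorem sum_mul_mixedG_zero (L : Site 2 → Matrix (Fin 4) (Fin 4) ℂ) (m : ℕ) (z : Site 2) :
    ∑ y ∈ box 2 m, L y * mixedG 0 (z - y) = if z ∈ box 2 m then L z else 0 := by
  ext ι κ
  rw [Matrix.sum_apply]
  simp only [Matrix.mul_apply, mixedG_eq_twistedTwoPoint]
  rw [sum_mul_twistedTwoPoint_zero]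
  split_ifs <;> rfl

/-- FINITE MODIFICATION: two kernels that agree from length 1 on, the first vanishing off the origin at
length 0, have comparable weights: summability transfers. -/
theorem summable_of_eqOn_succ {K L : ℕ → Site 2 → Matrix (Fin 4) (Fin 4) ℂ}
    (hKL : ∀ n, 1 ≤ n → K n = L n) (hK0 : ∀ z, z ≠ 0 → K 0 z = 0) (hL : Summable (l1Weight L)) :
    Summable (l1Weight K) := by
  have hmaj : Summable (fun p : ℕ × Site 2 => l1Weight L p +
      (if p = ((0 : ℕ), (0 : Site 2)) then ∑ ι : Fin 4, ∑ κ : Fin 4, ‖K 0 0 ι κ‖ else 0)) :=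
    hL.add (hasSum_ite_eq _ _).summable
  refine Summable.of_nonneg_of_le (l1Weight_nonneg K) (fun p => ?_) hmaj
  obtain ⟨n, z⟩ := p
  have hC : 0 ≤ (if (n, z) = ((0 : ℕ), (0 : Site 2)) then ∑ ι : Fin 4, ∑ κ : Fin 4, ‖K 0 0 ι κ‖
      else 0) := by
    split_ifs
    · exact Finset.sum_nonneg fun _ _ => Finset.sum_nonneg fun _ _ => norm_nonneg _
    · exact le_rfl
  rcases Nat.eq_zero_or_pos n with rfl | hn
  · by_cases hz : z = 0
    · subst hz
      rw [if_pos rfl]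
      unfold l1Weight
      rw [pow_zero, one_mul, one_mul]
      exact le_add_of_nonneg_left (Finset.sum_nonneg fun _ _ => Finset.sum_nonneg fun _ _ => norm_nonneg _)
    · have hzero : l1Weight K (0, z) = 0 := by
        unfold l1Weight
        simp [hK0 z hz]
      rw [hzero]
      exact add_nonneg (l1Weight_nonneg L _) hC
  · have heq : l1Weight K (n, z) = l1Weight L (n, z) := by
      unfold l1Weight
      rw [hKL n hn]
    rw [heq]
    exact le_add_of_nonneg_right hC

/-! ### 3. The typed (mixed) kernel: existence, uniqueness, reduction of the crux to one series -/

/-- The free (last-step) term of the item's recursion. -/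
def freeTerm (n : ℕ) (z : Site 2) : Matrix (Fin 4) (Fin 4) ℂ :=
  Matrix.of (fun ι κ => ∑ κ' : Fin 4, mixedG (n - 1) (z - stepDir κ) ι κ' * mixedT κ' κ)

/-- All mixed kernels up to length `N` (auxiliary for the course-of-values recursion). -/
def kernUpTo : ℕ → (ℕ → Site 2 → Matrix (Fin 4) (Fin 4) ℂ)
  | 0 => fun _ _ => 0
  | N + 1 => Function.update (kernUpTo N) (N + 1)
      (fun z => if z ∈ box 2 (N + 1) then
        mixedG (N + 1) z - freeTerm (N + 1) z -
          ∑ m ∈ Finset.Icc 1 N, ∑ y ∈ box 2 m, kernUpTo N m y * mixedG (N + 1 - m) (z - y)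
        else 0)

/-- THE mixed kernel: `K_0 = 0`,
`K_{N+1}(z) = 𝟙[z ∈ box(N+1)]·(G_{N+1}(z) − free_{N+1}(z) − Σ_{m=1}^{N} (K_m ⋆ G_{N+1-m})(z))`. -/
def kern (n : ℕ) : Site 2 → Matrix (Fin 4) (Fin 4) ℂ := kernUpTo n n

theorem kernUpTo_of_le : ∀ N m, m ≤ N → kernUpTo N m = kern m := by
  intro N
  induction N with
  | zero =>
    intro m hm
    obtain rfl := Nat.le_zero.1 hm
    rfl
  | succ N ih =>
    intro m hm
    rcases Nat.lt_or_eq_of_le hm with h | rfl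
    · have hne : m ≠ N + 1 := by omega
      show Function.update (kernUpTo N) (N + 1) _ m = kern m
      rw [Function.update_of_ne hne]
      exact ih m (by omega)
    · rfl

theorem kern_zero (z : Site 2) : kern 0 z = 0 := rfl

theorem kern_succ (N : ℕ) (z : Site 2) :
    kern (N + 1) z = if z ∈ box 2 (N + 1) then
        mixedG (N + 1) z - freeTerm (N + 1) z -
          ∑ m ∈ Finset.Icc 1 N, ∑ y ∈ box 2 m, kern m y * mixedG (N + 1 - m) (z - y)
        else 0 := by
  show Function.update (kernUpTo N) (N + 1) _ (N + 1) z = _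
  rw [Function.update_self]
  show (if z ∈ box 2 (N + 1) then
        mixedG (N + 1) z - freeTerm (N + 1) z -
          ∑ m ∈ Finset.Icc 1 N, ∑ y ∈ box 2 m, kernUpTo N m y * mixedG (N + 1 - m) (z - y)
        else 0) = _
  split_ifs with hz
  · congr 1
    refine Finset.sum_congr rfl fun m hm => Finset.sum_congr rfl fun y _ => ?_
    rw [kernUpTo_of_le N m (Finset.mem_Icc.1 hm).2]
  · rfl

/-- **Non-vacuity**: the explicit kernel `kern` satisfies the item's hypothesis. -/
theorem isMixedKernel_kern : IsMixedKernel kern := by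
  have hG : mixedG = twistedTwoPoint (5 / 8) := mixedG_eq_twistedTwoPoint
  refine ⟨?_, ?_⟩
  · intro n z hz
    cases n with
    | zero => rfl
    | succ N => rw [kern_succ, if_neg hz]
  · intro n hn z
    obtain ⟨N, rfl⟩ : ∃ N, n = N + 1 := ⟨n - 1, by omega⟩
    rw [Finset.sum_Icc_succ_top (show 1 ≤ N + 1 by omega), Nat.sub_self, sum_mul_mixedG_zero]
    by_cases hz : z ∈ box 2 (N + 1)
    · rw [if_pos hz, kern_succ, if_pos hz]
      unfold freeTerm
      abel
    · rw [if_neg hz]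
      have h0 : mixedG (N + 1) z = 0 := by
        rw [hG]
        exact twistedTwoPoint_eq_zero_of_notMem_box _ hz
      have hfree : (Matrix.of fun ι κ => ∑ κ' : Fin 4,
          mixedG (N + 1 - 1) (z - stepDir κ) ι κ' * mixedT κ' κ) = 0 := by
        ext ι κ
        rw [Matrix.of_apply, Matrix.zero_apply]
        refine Finset.sum_eq_zero fun κ' _ => ?_
        have hb : z - stepDir κ ∉ box 2 (N + 1 - 1) :=
          sub_notMem_box (stepDir_mem_box_one κ) hz (by omega)
        rw [hG, twistedTwoPoint_eq_zero_of_notMem_box _ hb, Matrix.zero_apply, zero_mul]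
      have hconv : ∑ m ∈ Finset.Icc 1 N, ∑ y ∈ box 2 m, kern m y * mixedG (N + 1 - m) (z - y) = 0 := by
        refine Finset.sum_eq_zero fun m hm => Finset.sum_eq_zero fun y hy => ?_
        have hmN : m ≤ N + 1 := by have := (Finset.mem_Icc.1 hm).2; omega
        rw [hG, twistedTwoPoint_eq_zero_of_notMem_box _ (sub_notMem_box hy hz hmN), mul_zero]
      rw [h0, hfree, hconv]
      simp

/-- **Uniqueness from length 1 on** (the `m = n` term isolates `K_n(z)` on the box; support off it). -/
theorem isMixedKernel_unique {K K' : ℕ → Site 2 → Matrix (Fin 4) (Fin 4) ℂ}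
    (hK : IsMixedKernel K) (hK' : IsMixedKernel K') : ∀ n, 1 ≤ n → K n = K' n := by
  intro n
  induction n using Nat.strong_induction_on with
  | _ n ih =>
    intro hn
    obtain ⟨N, rfl⟩ : ∃ N, n = N + 1 := ⟨n - 1, by omega⟩
    funext z
    by_cases hz : z ∈ box 2 (N + 1)
    · have h1 := hK.2 (N + 1) hn z
      have h2 := hK'.2 (N + 1) hn z
      rw [Finset.sum_Icc_succ_top (show 1 ≤ N + 1 by omega), Nat.sub_self, sum_mul_mixedG_zero,
        if_pos hz] at h1 h2
      have hmid : ∑ m ∈ Finset.Icc 1 N, ∑ y ∈ box 2 m, K m y * mixedG (N + 1 - m) (z - y) =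
          ∑ m ∈ Finset.Icc 1 N, ∑ y ∈ box 2 m, K' m y * mixedG (N + 1 - m) (z - y) := by
        refine Finset.sum_congr rfl fun m hm => Finset.sum_congr rfl fun y _ => ?_
        have hm' := Finset.mem_Icc.1 hm
        rw [ih m (by omega) hm'.1]
      rw [hmid] at h1
      exact add_left_cancel (add_left_cancel (h1.symm.trans h2))
    · rw [hK.1 _ _ hz, hK'.1 _ _ hz]

theorem exists_isMixedKernel : ∃ K, IsMixedKernel K := ⟨kern, isMixedKernel_kern⟩

/-- **The typed crux is ONE numerical series**: `TwistedKernelSummable ↔ Σ_{(n,z)} x_c^n Σ|kern n z| < ∞`. -/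
theorem crux_iff_kern :
    Summit.CriticalPhenomena.SAWScalingLimit.Theses.SAWTwistedSelfEnergy.TwistedKernelSummable ↔
      Summable (l1Weight kern) := by
  rw [crux_iff]
  constructor
  · exact fun h => h kern isMixedKernel_kern
  · intro hs K hK
    refine summable_of_eqOn_succ (fun n hn => isMixedKernel_unique hK isMixedKernel_kern n hn)
      (fun z hz => hK.1 0 z fun hz' => hz (eq_zero_of_not_notMem_box_zero (not_not.2 hz'))) hs

/-! ### 4. The repaired (first-step) statement: its unique kernel is the lace self-energy -/

/-- **Existence for the repair**: `Π^{5/8} = twistedLaceCoefficient (5/8)` solves the first-step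
recursion (the landed twisted NoBLE identity `twistedTwoPoint_succ` + support). -/
theorem isLaceKernel_lace : IsLaceKernel (twistedLaceCoefficient (5 / 8)) := by
  refine ⟨fun n z hz => twistedLaceCoefficient_eq_zero_of_notMem_box _ hz, ?_⟩
  intro n hn z
  obtain ⟨N, rfl⟩ : ∃ N, n = N + 1 := ⟨n - 1, by omega⟩
  rw [mixedG_eq_twistedTwoPoint, mixedT_eq_twistedStepMatrix, Nat.add_sub_cancel]
  exact twistedTwoPoint_succ (5 / 8) N z

/-- **Uniqueness for the repair** (same argument: the free term is never used). -/
theorem isLaceKernel_unique {K K' : ℕ → Site 2 → Matrix (Fin 4) (Fin 4) ℂ}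
    (hK : IsLaceKernel K) (hK' : IsLaceKernel K') : ∀ n, 1 ≤ n → K n = K' n := by
  intro n
  induction n using Nat.strong_induction_on with
  | _ n ih =>
    intro hn
    obtain ⟨N, rfl⟩ : ∃ N, n = N + 1 := ⟨n - 1, by omega⟩
    funext z
    by_cases hz : z ∈ box 2 (N + 1)
    · have h1 := hK.2 (N + 1) hn z
      have h2 := hK'.2 (N + 1) hn z
      rw [Finset.sum_Icc_succ_top (show 1 ≤ N + 1 by omega), Nat.sub_self, sum_mul_mixedG_zero,
        if_pos hz] at h1 h2
      have hmid : ∑ m ∈ Finset.Icc 1 N, ∑ y ∈ box 2 m, K m y * mixedG (N + 1 - m) (z - y) =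
          ∑ m ∈ Finset.Icc 1 N, ∑ y ∈ box 2 m, K' m y * mixedG (N + 1 - m) (z - y) := by
        refine Finset.sum_congr rfl fun m hm => Finset.sum_congr rfl fun y _ => ?_
        have hm' := Finset.mem_Icc.1 hm
        rw [ih m (by omega) hm'.1]
      rw [hmid] at h1
      exact add_left_cancel (add_left_cancel (h1.symm.trans h2))
    · rw [hK.1 _ _ hz, hK'.1 _ _ hz]

/-- **The repair says what the card says**: `C′ ↔ LaceKernelSummable` (birth stub 2 / card K1). -/
theorem repaired_iff_laceKernelSummable : TwistedKernelSummableFirstStep ↔ LaceKernelSummable := by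
  constructor
  · exact fun h => h _ isLaceKernel_lace
  · intro hs K hK
    refine summable_of_eqOn_succ (fun n hn => isLaceKernel_unique hK isLaceKernel_lace n hn)
      (fun z hz => hK.1 0 z fun hz' => hz (eq_zero_of_not_notMem_box_zero (not_not.2 hz'))) hs

end Summit.CriticalPhenomena.SAWScalingLimit.Cruxes.TwistedKernelSummable.Disproof

end
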